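import Summits.ABC.IUTFork.Cor312SettingMSharpRoutes
import Summits.ABC.IUTFork.Thm311RealDegreeM
import Summits.ABC.IUTFork.Cor312ProvenanceGenuine
import Summits.ABC.IUTFork.Cor312ProvenanceReal
import Summits.ABC.IUTFork.Cor312ProvenanceQ
import HarnessLib

/-!
# [IUTchIII] Corollary 3.12 — the NUMBER `−|log(q)|` of the M-LEVEL real settings (`K_{v̲}`, `v̲ ∈ V̲`) with the `q`-centre
# read off `q`-ideles IS `−deĝ_{F_mod}(P_q) = −(1/2l)·log(q)` ([IUTchIV] p. 23) — the `q`-side of G1 and the M-level provenance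
# (G1-Θ unit P5-numbers of `HOME/staging/w5/w5-d166/g4/G1-THETA-SHAPES.md`)

PROOF-ONLY record file (D-0012; no definitions) of the abc-iut cell (seat abc-iut-w5-d244, gen 8; branch C «abc ⇐ S», C-lead
ruling C-R12 (e) «target #2′: the M-level (V̲, K_{v̲}) real volume setting»). TAKES NO SIDE on [IUTchIII] Cor. 3.12.
[IUTchIII] Cor. 3.12 (kurims `paper:url-4b091feeb646` p. 174 l. 4–13): "`−|log(q)| ∈ ℝ` [is] the procession-normalized
mono-analytic log-volume of the image of a `q`-pilot object … In particular, `|log(q)| > 0` is easily computed in terms of the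
various `q`-parameters of the elliptic curve `E_F` … at `v ∈ 𝕍^bad (≠ ∅)`"; [IUTchIV] Thm. 1.10 (kurims `paper:url-56bcb0f95768`
p. 23): "the quantity “`|log(q)| ∈ ℝ_{>0}`” defined in [IUTchIII], Corollary 3.12, is equal to `(1/2l)·log(q) ∈ ℝ`".

abc-iut-c312-7's `Cor312PilotIdelesPrNumbers` computed that number IN THE KERNEL at the F-LEVEL print-normalised setting
(pilot data `X` over `F`, completions of `F`). THIS FILE is its M-LEVEL twin over abc-iut-c312-5's skeleton
`Real.thetaIndexOfInitial D` and the GENUINE carriers `K_{v̲}` ([IUTchI] Def. 3.1 (e), kurims `paper:url-690e7b3c6199` p. 62;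
Dupuy–Hilado Def. 3.6.1), for the summand-route setting `Real.settingPrVolM` (abc-iut-w4-d013, unit P3) with abc-iut-w5-d166's
`q`-centre `qCentreM tq` (unit P4-frames) and, by abc-iut-w4-d013's route bridge `negLogQ_settingMSharp_eq`, for the lead's
frames-route sharp setting `Real.settingMSharp`:

* §1 for `q`-ideles `t_{q,v̲} ∈ K_{v̲}` REALISING an arbitrary real divisor `Q` on the finite places of `F_mod` in Dupuy–Hilado's
  normalisation (3.4) (`log ‖t_{q,v̲(x)}‖ = −Q(v(x))·ln|κ(v(x))|/n_{v(x)}`): `qLocal_settingPrVolM_qCentreM_arc = 0`,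
  **`qLocal_settingPrVolM_qCentreM_non`**: `−|log(q)|_{j,u} = −(1/[F_mod:ℚ])·Σ_{v ∈ V(F_mod)_{p_u}} Q(v)·log N(v)` at EVERY label `j`
  (abc-iut-c312-3's `factorMap_preimage_hullSet_centreOf` at `presAtM`: the `q`-region is `e⁻¹(Π_{v̲⃗} ι_j(t_{q,v̲_j})·(R_I)^∼)`, summand
  log-measures `log ‖t_{q,v̲_j}‖` by (3.7); then this seat's expectation identity `logvol_preimage_pi_PrM_of_last`, unit P2);
* §2 the places of `F_mod` over `p_u` are exactly those whose place of `ℚ` below is `u` (`mem_placesOver_ratChar_iff`, via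
  abc-iut-w5-d033's `under_rat_eq_maximalIdeal`), so the local `q`-volumes are supported under the support of `Q`
  (`support_qLocal_settingPrVolM_qCentreM_subset`) and **`finsum_qLocal_settingPrVolM_qCentreM = −deĝ_{F_mod}(Q)`** (prime by prime,
  [IUTchIII] Prop. 3.9 (iii));
* §3 **`negLogQ_settingPrVolM_qCentreM`** / **`negLogQ_settingMSharp`**: `P.negLogQ = −FinDivisor.ndeg (fieldOfModuli E) Q` on both
  routes (procession average of a label-independent quantity; Dupuy–Hilado Thm. 3.10.1 (iii) for the `q`-pilot);
* §4 THE GENUINE INSTANCE: for the `q`-ideles `tqM` of the idele data `r` of `D` (abc-iut-w5-d033 `Cor312PilotIdelesMRead`; the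
  realisation `log_norm_tqM`, non-vanishing `tqM_ne_zero` and unit-off-`𝕍^bad_mod` `norm_tqM_eq_one_of_not_mem` are THEOREMS there,
  so no realisation hypothesis survives — the point of route β), `Q := (pilotData D).qPilot`: **`negLogQ_settingMSharp_tqM =
  −deĝ_{F_mod}(P_q)`**, `= (volumeInputOf D r).negAbsLogQ` (abc-iut-S2's genuine `−|log(q)|`, `IsVolumeInputOf.negAbsLogQ_eq`) and
  `= −absLogq D = −(1/2l)·log(q)` of the initial Θ-data (abc-iut-c312-8's `negAbsLogQ_eq_neg_absLogq_of_isVolumeInputOf`); hence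
  **`isSettingOf_settingMSharp_tqM : Cor312Prov.IsSettingOf D (settingMSharp …)`** (c312-8's `isSettingOf_ofInitial`) — the
  M-level provenance link of the adjudication spec, and **`absLogQPos_settingMSharp_tqM`** ("`|log(q)| > 0`").

[cite: Mochizuki2012, IUTchIII Cor. 3.12 p. 174] [cite: Mochizuki2012, IUTchIV Thm. 1.10 p. 23] [cite: Mochizuki2012, IUTchI Def. 3.1 (e) p. 62]
[cite: DupuyHilado2025, §3.4, §3.7, §3.9, Thm. 3.10.1] [claim: Mochizuki2012, status: disputed] for the quoted sentences.
HONEST FRAMING: a computation of ONE of the two printed quantities at the M-level instantiation; nothing here bears on `−|log(Θ)|`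
or on the inequality of Cor. 3.12; no edit to any other seat's file; typed ≠ proved; instantiated ≠ endorsed.
Deliberately NOT here: the Θ-side comparison with `ThetaVolumeInput.negLogTheta` (unit P6), the Shrink certificate (P7).
-/

noncomputable section

open Set Function NumberField IsDedekindDomain
open scoped Pointwise

namespace Summit.ABC.IUTFork.Thm311.Real

open Cor312 Cor312Vol Cor312Prov Literature.IUT.LogThetaLattice Literature.IUT.LogVolume Literature.IUT.HodgeTheaters
  Literature.NumberTheory.NumberFields

variable {F K Fbar : Type} [Field F] [NumberField F] [Field K] [NumberField K] [Algebra F K]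
  [Field Fbar] [Algebra F Fbar] [Algebra K Fbar] {E : WeierstrassCurve F} [E.IsElliptic] {l : ℕ}
  {Pb : BadPlacePredicates K} (D : InitialThetaData F K Fbar E l Pb) {logvK : PadicLogsVal K}
  (hlog : LogvAnalyticVal logvK)

/-! ## §0. The places of `F_mod` over `p_u` are the places whose place of `ℚ` below is `u` -/

/-- The residue characteristic of a place of `F_mod` is that of the place of `ℚ` below it (`Ideal.under_under`).
[cite: DupuyHilado2025, §2.5.4] -/
theorem residueChar_under_rat (v : HeightOneSpectrum (𝓞 (fieldOfModuli E))) :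
    residueChar ℚ (v.under (𝓞 ℚ)) = residueChar (fieldOfModuli E) v := by
  show Ideal.absNorm ((v.under (𝓞 ℚ)).asIdeal.under ℤ) = Ideal.absNorm (v.asIdeal.under ℤ)
  rw [HeightOneSpectrum.under_asIdeal, Ideal.under_under]

/-- **`v ∈ V(F_mod)_{p_u}` iff the place of `ℚ` under `v` is `u`** (both places of `ℚ` contain `p_u`: abc-iut-w5-d033's
`under_rat_eq_maximalIdeal`; conversely the residue characteristics agree). [cite: NeukirchANT1999, Ch. I §8] -/
theorem mem_placesOver_ratChar_iff (v : HeightOneSpectrum (𝓞 (fieldOfModuli E))) (u : FinitePlace ℚ) :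
    v ∈ placesOver (fieldOfModuli E) (ratChar u) ↔ Val.non (FinitePlace.mk (v.under (𝓞 ℚ))) = Val.non u := by
  constructor
  · intro hv
    rw [under_rat_eq_maximalIdeal (E := E) (ratChar u) u (natCast_ratChar_mem u) ⟨v, hv⟩, FinitePlace.mk_maximalIdeal]
  · intro h
    have h1 : FinitePlace.mk (v.under (𝓞 ℚ)) = u := Sum.inr_injective h
    rw [mem_placesOver_iff_residueChar, ← residueChar_under_rat, ratChar, ← h1, FinitePlace.maximalIdeal_mk]

/-! ## §1. The local `q`-volumes of the summand-route setting with the `q`-centre read off ideles -/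

section QNumber

variable (M : Type) [Field M] [NumberField M]
  (archPk : ∀ (j : (thetaIndexOfInitial D).Label) (vQ : (thetaIndexOfInitial D).VQ),
    Set ((logShellsOfInitialDH D logvK).Packet j vQ))
  (archSub : ∀ (j : (thetaIndexOfInitial D).Label) (v : (thetaIndexOfInitial D).V),
    Set ((logShellsOfInitialDH D logvK).Packet j ((thetaIndexOfInitial D).over v)))
  (Ψ : ℤ → ∀ v : (thetaIndexOfInitial D).V, v ∈ (thetaIndexOfInitial D).Vbad →
    Set ((logShellsOfInitialDH D logvK).StarPacket v))
  (act : ℤ → ∀ v : (thetaIndexOfInitial D).V, v ∈ (thetaIndexOfInitial D).Vbad →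
    (logShellsOfInitialDH D logvK).StarPacket v → Module.End ℚ ((logShellsOfInitialDH D logvK).StarPacket v))
  (Mmod : ℤ → ∀ j : (thetaIndexOfInitial D).LabelStar, Set ((logShellsOfInitialDH D logvK).GlobalPacket j.1))
  (region : ℤ → ∀ j : (thetaIndexOfInitial D).LabelStar, FinDivisor M → ∀ vQ : (thetaIndexOfInitial D).VQ,
    Set ((logShellsOfInitialDH D logvK).Packet j.1 vQ))
  (n : ℤ) {HT : Type} {LogLink : HT → HT → Type} {IsFull : ∀ {s t : HT}, LogLink s t → Prop}
  (lat : LGPGaussianLogThetaLattice LogLink IsFull)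
  {Frd : Type} {IsoF : Frd → Frd → Type} {Ob : Frd → Type} {realify : Frd → Frd} {Strip : Type}
  {IsoS : Strip → Strip → Type}
  {Mv : ∀ v : (thetaIndexOfInitial D).V, v ∈ (thetaIndexOfInitial D).Vbad → Type} [∀ v h, Monoid (Mv v h)]
  (sig : GlobalLGPFrobenioidSignature (thetaIndexOfInitial D).lstar (thetaIndexOfInitial D).V
    (· ∈ (thetaIndexOfInitial D).Vbad) Frd IsoF Ob realify Strip IsoS Mv)
  (split : SplittingMonoids Mv) {ObΔ : Type}
  {N : ∀ v : (thetaIndexOfInitial D).V, v ∈ (thetaIndexOfInitial D).Vbad → Type} [∀ v h, Monoid (N v h)]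
  (qData : QPilotData ObΔ N)
  (thetaBox : ℤ → Ob sig.Clgp → ∀ (j : (thetaIndexOfInitial D).Label) (vQ : (thetaIndexOfInitial D).VQ),
    Set (∀ s : factorIdxM D hlog j vQ, factorFieldM D hlog j vQ s))
  (tq : ∀ (u : FinitePlace ℚ) (x : (thetaIndexOfInitial D).Fibre (Val.non u)),
    kOfM D (ratChar u) u (natCast_ratChar_mem u) x)
  (htq0 : ∀ u x, tq u x ≠ 0)
  (hfin : ∀ j : (thetaIndexOfInitial D).Label, (Function.support fun vQ =>
    ((situationPrVolM D hlog M archPk archSub Ψ act Mmod region).D n).logvol j vQ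
      (factorMapM D hlog j vQ ⁻¹' hullSet (factorFieldM D hlog j vQ) (qCentreM D hlog tq j vQ))).Finite)
  /- the `q`-ideles REALISE the divisor `Q` on the finite places of `F_mod` in Dupuy–Hilado's normalisation (3.4) -/
  (Q : HeightOneSpectrum (𝓞 (fieldOfModuli E)) →₀ ℝ)
  (htq : ∀ (u : FinitePlace ℚ) (x : (thetaIndexOfInitial D).Fibre (Val.non u)),
    Real.log ‖tq u x‖ = -(Q (placeModOfM D u x)) * logNorm (fieldOfModuli E) (placeModOfM D u x) /
      localDegree (fieldOfModuli E) (placeModOfM D u x))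

/-- At an archimedean place the local `q`-volume is `0` (trivial archimedean container of the M-level files — weights `0`).
[folklore] -/
theorem qLocal_settingPrVolM_qCentreM_arc (j : (thetaIndexOfInitial D).Label) (w : InfinitePlace ℚ) :
    (settingPrVolM D hlog M archPk archSub Ψ act Mmod region n lat sig split qData thetaBox (fun _ => qCentreM D hlog tq)
        (fun j vQ s => qCentreM_ne_zero D hlog tq htq0 j vQ s) hfin).qLocal j (Val.arc w) = 0 :=
  logvol_summandPiecesPrM_arc D hlog j w _

include htq

/-- **`−|log(q)|` locally at a finite place `u` of `ℚ`, packet-normalised, M level**: for `q`-ideles realising `Q`, the local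
`q`-volume of `settingPrVolM … (qCentreM tq) …` at `(j, u)` is `−(1/[F_mod:ℚ])·Σ_{v ∈ V(F_mod)_{p_u}} Q(v)·log N(v)` — for EVERY label `j`
(the `q`-region is `e⁻¹(Π_{v̲⃗} ι_j(t_{q,v̲_j})·(R_I)^∼)`, abc-iut-c312-3's `factorMap_preimage_hullSet_centreOf`, with summand log-measures
`log ‖t_{q,v̲_j}‖` by (3.7); then the expectation identity `logvol_preimage_pi_PrM_of_last` with `c := −Q`).
[cite: DupuyHilado2025, §3.9, Thm. 3.10.1] -/
theorem qLocal_settingPrVolM_qCentreM_non (j : (thetaIndexOfInitial D).Label) (u : FinitePlace ℚ) :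
    (settingPrVolM D hlog M archPk archSub Ψ act Mmod region n lat sig split qData thetaBox (fun _ => qCentreM D hlog tq)
        (fun j vQ s => qCentreM_ne_zero D hlog tq htq0 j vQ s) hfin).qLocal j (Val.non u) =
      (∑ v ∈ placesOver (fieldOfModuli E) (ratChar u), -(Q v) * logNorm (fieldOfModuli E) v) /
        Module.finrank ℚ (fieldOfModuli E) := by
  haveI : Nonempty ((thetaIndexOfInitial D).Caps j) := ⟨0⟩
  have hg : ∀ (e : (thetaIndexOfInitial D).Caps j → (thetaIndexOfInitial D).Fibre (Val.non u))
      (i : DIdx (ratChar u) ((presAtM D hlog u).kk e)),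
      dEquiv (ratChar u) ((presAtM D hlog u).kk e)
        (iota (ratChar u) ((presAtM D hlog u).kk e) (Fin.last _) (tq u (e (Fin.last _)))) i ≠ 0 :=
    fun e i => dEquiv_iota_ne_zero (ratChar u) _ (Fin.last _) (htq0 u _) i
  have h := (presAtM D hlog u).factorMap_preimage_hullSet_centreOf
    (fun e => iota (ratChar u) ((presAtM D hlog u).kk e) (Fin.last _) (tq u (e (Fin.last _)))) hg
  have hadm : ∀ e : (thetaIndexOfInitial D).Caps j → (thetaIndexOfInitial D).Fibre (Val.non u),
      PacketAdm (ratChar u) ((presAtM D hlog u).kk e)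
        (iota (ratChar u) ((presAtM D hlog u).kk e) (Fin.last _) (tq u (e (Fin.last _))) •
          (normalizedPacket (ratChar u) ((presAtM D hlog u).kk e) : Set ((presAtM D hlog u).X e))) :=
    fun e => packetAdm_iota_smul (ratChar u) _ (Fin.last _) (htq0 u _) (packetAdm_normalizedPacket (ratChar u) _)
  change (summandPiecesPrM D hlog).logvol j (Val.non u)
    ((fun x => (presAtM D hlog u).factorMap j x) ⁻¹'
      hullSet ((presAtM D hlog u).factorField j) ((presAtM D hlog u).centreOf fun e =>
        iota (ratChar u) ((presAtM D hlog u).kk e) (Fin.last _) (tq u (e (Fin.last _))))) = _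
  rw [h]
  refine logvol_preimage_pi_PrM_of_last D hlog u j _ hadm (fun v => -(Q v)) fun e => ?_
  rw [packetLogμ_iota_smul_normalizedPacket (ratChar u) _ (Fin.last _) (htq0 u _)]
  exact htq u _

/-! ## §2. The global `q`-volume at every label -/

open scoped Classical in
/-- The local `q`-volumes vanish off the places of `ℚ` under the support of `Q`: "all but finitely many of which are zero!"
([IUTchIII] Prop. 3.9 (iii)). [claim: Mochizuki2012, status: disputed] -/
theorem support_qLocal_settingPrVolM_qCentreM_subset (j : (thetaIndexOfInitial D).Label) :
    (Function.support fun vQ : (thetaIndexOfInitial D).VQ =>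
        (settingPrVolM D hlog M archPk archSub Ψ act Mmod region n lat sig split qData thetaBox
          (fun _ => qCentreM D hlog tq) (fun j vQ s => qCentreM_ne_zero D hlog tq htq0 j vQ s) hfin).qLocal j vQ) ⊆
      ↑((Q.support.image fun v => Val.non (FinitePlace.mk (v.under (𝓞 ℚ))) : Finset (thetaIndexOfInitial D).VQ)) := by
  intro vQ hvQ
  rw [Function.mem_support] at hvQ
  rcases vQ with w | u
  · exact absurd (qLocal_settingPrVolM_qCentreM_arc D hlog M archPk archSub Ψ act Mmod region n lat sig split qData
      thetaBox tq htq0 hfin j w) hvQ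
  · rw [show (Sum.inr u : (thetaIndexOfInitial D).VQ) = Val.non u from rfl,
      qLocal_settingPrVolM_qCentreM_non D hlog M archPk archSub Ψ act Mmod region n lat sig split qData thetaBox tq
      htq0 hfin Q htq j u] at hvQ
    obtain ⟨v, hv, hJv⟩ : ∃ v ∈ placesOver (fieldOfModuli E) (ratChar u), -(Q v) * logNorm (fieldOfModuli E) v ≠ 0 := by
      by_contra hcon
      simp only [not_exists, not_and, not_not] at hcon
      exact hvQ (by rw [Finset.sum_eq_zero hcon, zero_div])
    rw [Finset.coe_image, Set.mem_image]
    refine ⟨v, Finset.mem_coe.mpr (Finsupp.mem_support_iff.mpr fun h0 => hJv (by simp [h0])), ?_⟩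
    exact (mem_placesOver_ratChar_iff v u).mp hv

open scoped Classical in
/-- **The global `q`-volume at every label is `−deĝ_{F_mod}(Q)`**: `Σ_{v_ℚ} −|log(q)|_{j,v_ℚ} = −(1/[F_mod:ℚ])·Σ_v Q(v)·log N(v)
= −FinDivisor.ndeg F_mod Q` ([IUTchIII] Prop. 3.9 (iii): the global log-volume of the region determined by an arithmetic line bundle
is its normalized degree; Dupuy–Hilado Thm. 3.10.1 for the `q`-pilot, prime by prime). [cite: DupuyHilado2025, Thm. 3.10.1] -/
theorem finsum_qLocal_settingPrVolM_qCentreM (j : (thetaIndexOfInitial D).Label) :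
    ∑ᶠ vQ : (thetaIndexOfInitial D).VQ,
        (settingPrVolM D hlog M archPk archSub Ψ act Mmod region n lat sig split qData thetaBox
          (fun _ => qCentreM D hlog tq) (fun j vQ s => qCentreM_ne_zero D hlog tq htq0 j vQ s) hfin).qLocal j vQ =
      -FinDivisor.ndeg (fieldOfModuli E) Q := by
  rw [finsum_eq_sum_of_support_subset _ (support_qLocal_settingPrVolM_qCentreM_subset D hlog M archPk archSub Ψ act
    Mmod region n lat sig split qData thetaBox tq htq0 hfin Q htq j),
    Finset.sum_image' (fun v => -(Q v) * logNorm (fieldOfModuli E) v / (Module.finrank ℚ (fieldOfModuli E) : ℝ))]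
  · -- `Σ_{v ∈ supp Q} −Q(v)·log N(v)/[F_mod:ℚ] = −deĝ(Q)`
    rw [FinDivisor.ndeg_apply, FinDivisor.deg_apply, Finsupp.sum, ← Finset.sum_div, ← neg_div,
      ← Finset.sum_neg_distrib]
    refine congrArg (· / _) (Finset.sum_congr rfl fun v _ => ?_)
    ring
  · -- the local `q`-volume at the place of `ℚ` under `v₀` is the sum over the fibre of `supp Q` over that place
    intro v₀ _
    rw [qLocal_settingPrVolM_qCentreM_non D hlog M archPk archSub Ψ act Mmod region n lat sig split qData thetaBox tq
      htq0 hfin Q htq j (FinitePlace.mk (v₀.under (𝓞 ℚ))), Finset.sum_div]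
    refine (Finset.sum_subset ?_ ?_).symm
    · intro v hv
      rw [Finset.mem_filter] at hv
      exact (mem_placesOver_ratChar_iff v _).mpr hv.2
    · intro v hv hv'
      rw [Finset.mem_filter, not_and'] at hv'
      have hJ : Q v = 0 := Finsupp.notMem_support_iff.mp (hv' ((mem_placesOver_ratChar_iff v _).mp hv))
      rw [hJ, neg_zero, zero_mul, zero_div]

/-! ## §3. `−|log(q)| = −deĝ_{F_mod}(Q)` on both routes -/

/-- **`−|log(q)| = −deĝ_{F_mod}(Q)` at the summand-route M-level setting**: the verbatim procession-normalized quantity `negLogQ`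
of [IUTchIII] Cor. 3.12 (abc-iut-c312-7's `Cor312Statement`, p. 174 l. 4–10) AT `settingPrVolM … (qCentreM tq) …` IS minus the
normalized degree of the divisor the `q`-ideles realise (the average over `j ∈ 𝔽_l^⋇` of a `j`-independent quantity).
[cite: DupuyHilado2025, Thm. 3.10.1] -/
theorem negLogQ_settingPrVolM_qCentreM :
    (settingPrVolM D hlog M archPk archSub Ψ act Mmod region n lat sig split qData thetaBox (fun _ => qCentreM D hlog tq)
        (fun j vQ s => qCentreM_ne_zero D hlog tq htq0 j vQ s) hfin).negLogQ =
      -FinDivisor.ndeg (fieldOfModuli E) Q := by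
  unfold Setting.negLogQ
  simp_rw [finsum_qLocal_settingPrVolM_qCentreM D hlog M archPk archSub Ψ act Mmod region n lat sig split qData thetaBox
    tq htq0 hfin Q htq]
  exact processionNormalized_const (lt_of_lt_of_le two_pos (thetaIndexOfInitial D).two_le_lstar) _

/-- **`−|log(q)| = −deĝ_{F_mod}(Q)` at abc-iut-w5-d166's FRAMES-ROUTE sharp setting `settingMSharp`** (any Θ-ideles `t`, any finite
`Sq` off which the `q`-ideles are units), by abc-iut-w4-d013's route bridge `negLogQ_settingMSharp_eq`.
[cite: DupuyHilado2025, Thm. 3.10.1] -/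
theorem negLogQ_settingMSharp
    (t : ∀ (u : FinitePlace ℚ) (_ : Fin (thetaIndexOfInitial D).lstar) (x : (thetaIndexOfInitial D).Fibre (Val.non u)),
      kOfM D (ratChar u) u (natCast_ratChar_mem u) x)
    (Sq : Finset (FinitePlace ℚ))
    (htq1 : ∀ (u : FinitePlace ℚ) (x : (thetaIndexOfInitial D).Fibre (Val.non u)), u ∉ Sq → ‖tq u x‖ = 1) :
    (settingMSharp D hlog M archPk archSub Ψ act Mmod region n lat sig split qData t tq htq0 Sq htq1).negLogQ =
      -FinDivisor.ndeg (fieldOfModuli E) Q := by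
  rw [negLogQ_settingMSharp_eq]
  exact negLogQ_settingPrVolM_qCentreM D hlog M archPk archSub Ψ act Mmod region n lat sig split qData _ tq htq0 _ Q htq

end QNumber

/-! ## §4. The genuine instance: the `q`-ideles of the idele data of `D` -/

section Genuine

variable (M : Type) [Field M] [NumberField M]
  (archPk : ∀ (j : (thetaIndexOfInitial D).Label) (vQ : (thetaIndexOfInitial D).VQ),
    Set ((logShellsOfInitialDH D logvK).Packet j vQ))
  (archSub : ∀ (j : (thetaIndexOfInitial D).Label) (v : (thetaIndexOfInitial D).V),
    Set ((logShellsOfInitialDH D logvK).Packet j ((thetaIndexOfInitial D).over v)))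
  (Ψ : ℤ → ∀ v : (thetaIndexOfInitial D).V, v ∈ (thetaIndexOfInitial D).Vbad →
    Set ((logShellsOfInitialDH D logvK).StarPacket v))
  (act : ℤ → ∀ v : (thetaIndexOfInitial D).V, v ∈ (thetaIndexOfInitial D).Vbad →
    (logShellsOfInitialDH D logvK).StarPacket v → Module.End ℚ ((logShellsOfInitialDH D logvK).StarPacket v))
  (Mmod : ℤ → ∀ j : (thetaIndexOfInitial D).LabelStar, Set ((logShellsOfInitialDH D logvK).GlobalPacket j.1))
  (region : ℤ → ∀ j : (thetaIndexOfInitial D).LabelStar, FinDivisor M → ∀ vQ : (thetaIndexOfInitial D).VQ,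
    Set ((logShellsOfInitialDH D logvK).Packet j.1 vQ))
  (n : ℤ) {HT : Type} {LogLink : HT → HT → Type} {IsFull : ∀ {s t : HT}, LogLink s t → Prop}
  (lat : LGPGaussianLogThetaLattice LogLink IsFull)
  {Frd : Type} {IsoF : Frd → Frd → Type} {Ob : Frd → Type} {realify : Frd → Frd} {Strip : Type}
  {IsoS : Strip → Strip → Type}
  {Mv : ∀ v : (thetaIndexOfInitial D).V, v ∈ (thetaIndexOfInitial D).Vbad → Type} [∀ v h, Monoid (Mv v h)]
  (sig : GlobalLGPFrobenioidSignature (thetaIndexOfInitial D).lstar (thetaIndexOfInitial D).V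
    (· ∈ (thetaIndexOfInitial D).Vbad) Frd IsoF Ob realify Strip IsoS Mv)
  (split : SplittingMonoids Mv) {ObΔ : Type}
  {N : ∀ v : (thetaIndexOfInitial D).V, v ∈ (thetaIndexOfInitial D).Vbad → Type} [∀ v h, Monoid (N v h)]
  (qData : QPilotData ObΔ N)
  (t : ∀ (u : FinitePlace ℚ) (_ : Fin (thetaIndexOfInitial D).lstar) (x : (thetaIndexOfInitial D).Fibre (Val.non u)),
    kOfM D (ratChar u) u (natCast_ratChar_mem u) x)
  (r : ThetaData.IdeleData D)
  /- any finite set of places of `ℚ` off which the genuine `q`-ideles are units (e.g. the places under `𝕍^bad_mod`: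
  abc-iut-w5-d033's `norm_tqM_eq_one_of_not_mem_image`, `Cor312PilotIdelesMReadRat`) -/
  (Sq : Finset (FinitePlace ℚ))
  (htq1 : ∀ (u : FinitePlace ℚ) (x : (thetaIndexOfInitial D).Fibre (Val.non u)), u ∉ Sq →
    ‖tqM D (ratChar u) u (natCast_ratChar_mem u) r x‖ = 1)

/-- **`−|log(q)| = −deĝ_{F_mod}(P_q)` FOR THE GENUINE `q`-IDELES OF `D`** at the frames-route sharp setting `settingMSharp` with
`tq := tqM` read off the idele data `r` of `D` (abc-iut-w5-d033's P4a: the realisation `log_norm_tqM` and the non-vanishing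
`tqM_ne_zero` are THEOREMS; the setting's binder «units off a finite `Sq`» is kept free and is discharged for the places under
`𝕍^bad_mod` by abc-iut-w5-d033's `norm_tqM_eq_one_of_not_mem_image`, `Cor312PilotIdelesMReadRat`) — no realisation hypothesis left. [cite: Mochizuki2012, IUTchIV Thm. 1.10 p. 23] -/
theorem negLogQ_settingMSharp_tqM :
    (settingMSharp D hlog M archPk archSub Ψ act Mmod region n lat sig split qData t
        (fun u x => tqM D (ratChar u) u (natCast_ratChar_mem u) r x)
        (fun u x => tqM_ne_zero D (ratChar u) u (natCast_ratChar_mem u) r x)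
        Sq htq1).negLogQ =
      -FinDivisor.ndeg (fieldOfModuli E) (ThetaData.pilotData D).qPilot :=
  negLogQ_settingMSharp D hlog M archPk archSub Ψ act Mmod region n lat sig split qData _ _ (ThetaData.pilotData D).qPilot
    (fun u x => log_norm_tqM D (ratChar u) u (natCast_ratChar_mem u) r x) t Sq htq1

/-- **… `= −|log(q)|` of abc-iut-S2's GENUINE Θ-volume input** `volumeInputOf D r` (`ThetaVolumeInput.negAbsLogQ`,
`IsVolumeInputOf.negAbsLogQ_eq`): the `q`-sides of the M-level setting and of the genuine input are ONE number — the binder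
`hq` of the branch-C certificates DISCHARGED at the M level. [cite: Mochizuki2012, IUTchIV Thm. 1.10 p. 23] -/
theorem negLogQ_settingMSharp_tqM_eq_negAbsLogQ :
    (settingMSharp D hlog M archPk archSub Ψ act Mmod region n lat sig split qData t
        (fun u x => tqM D (ratChar u) u (natCast_ratChar_mem u) r x)
        (fun u x => tqM_ne_zero D (ratChar u) u (natCast_ratChar_mem u) r x)
        Sq htq1).negLogQ =
      (ThetaData.volumeInputOf D r).negAbsLogQ := by
  rw [negLogQ_settingMSharp_tqM, (ThetaData.isVolumeInputOf_volumeInputOf D r).negAbsLogQ_eq]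

/-- **… `= −(1/2l)·log(q)` of the initial Θ-data** (abc-iut-c312-8's `absLogq D`; [IUTchIV] Thm. 1.10 p. 23 "the quantity
“`|log(q)|`” defined in [IUTchIII], Corollary 3.12, is equal to `(1/2l)·log(q)`"), by c312-8's provenance of the genuine input
`negAbsLogQ_eq_neg_absLogq_of_isVolumeInputOf`. [cite: Mochizuki2012, IUTchIV Thm. 1.10 p. 23] -/
theorem negLogQ_settingMSharp_tqM_eq_neg_absLogq :
    (settingMSharp D hlog M archPk archSub Ψ act Mmod region n lat sig split qData t
        (fun u x => tqM D (ratChar u) u (natCast_ratChar_mem u) r x)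
        (fun u x => tqM_ne_zero D (ratChar u) u (natCast_ratChar_mem u) r x)
        Sq htq1).negLogQ = -absLogq D := by
  rw [negLogQ_settingMSharp_tqM_eq_negAbsLogQ]
  exact negAbsLogQ_eq_neg_absLogq_of_isVolumeInputOf D (ThetaData.isVolumeInputOf_volumeInputOf D r)

/-- **THE M-LEVEL PROVENANCE LINK HOLDS for the frames-route sharp setting with the genuine `q`-ideles**: abc-iut-c312-8's
`Cor312Prov.IsSettingOf D (settingMSharp …)` — index skeleton `(l−1)/2`, `V = V̲`, `𝕍^bad = V̲^bad` by construction
(`isSettingOf_ofInitial`), and the quantitative clause `−|log(q)| = −(1/2l)·log(q)` by the preceding theorem; the Θ-ideles `t`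
and every context binder stay free. [claim: Mochizuki2012, status: disputed] -/
theorem isSettingOf_settingMSharp_tqM :
    IsSettingOf D (settingMSharp D hlog M archPk archSub Ψ act Mmod region n lat sig split qData t
        (fun u x => tqM D (ratChar u) u (natCast_ratChar_mem u) r x)
        (fun u x => tqM_ne_zero D (ratChar u) u (natCast_ratChar_mem u) r x)
        Sq htq1) :=
  isSettingOf_ofInitial D _ (negLogQ_settingMSharp_tqM_eq_neg_absLogq D hlog M archPk archSub Ψ act Mmod region n lat sig
    split qData t r Sq htq1)

/-- **"In particular, `|log(q)| > 0`"** ([IUTchIII] Cor. 3.12, p. 174 l. 13; abc-iut-c312-7's `AbsLogQPos := negLogQ < 0`) for the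
M-level sharp setting with the genuine `q`-ideles (c312-8's `absLogq_pos`: `log(q) > 0`, `l ≥ 5`).
[claim: Mochizuki2012, status: disputed] -/
theorem absLogQPos_settingMSharp_tqM :
    (settingMSharp D hlog M archPk archSub Ψ act Mmod region n lat sig split qData t
        (fun u x => tqM D (ratChar u) u (natCast_ratChar_mem u) r x)
        (fun u x => tqM_ne_zero D (ratChar u) u (natCast_ratChar_mem u) r x)
        Sq htq1).AbsLogQPos :=
  (absLogQPos_iff _ (isSettingOf_settingMSharp_tqM D hlog M archPk archSub Ψ act Mmod region n lat sig split qData t r Sq htq1)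
    (by have := D.five_le_l; omega)).mpr (logq_pos D)

end Genuine

end Summit.ABC.IUTFork.Thm311.Real

end
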